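import Mathlib
import Literature.MathematicalPhysics.QuantumFieldTheory.MullerSchiemann1987.MS87HeatKernelComplex
import Literature.MathematicalPhysics.QuantumLattice.SU2Haar
import HarnessLib

/-!
# Müller–Schiemann, *Continuum limit of a hierarchical SU(2) lattice gauge theory in 4 dimensions*
# (CMP 110, 1987), Sect. 2 FOR THE HEAT-KERNEL ACTION: the analytically continued Gibbs factor
# `g̃_HK(u, z)` of (2.6)–(2.7)/(2.21), the identities (2.16)–(2.17), (2.8)–(2.12), and the induction
# hypothesis (A₁) of Sect. 3 for `g̃_HK` — PROVED

statement-level skeleton of published theorems with citation tags; proofs where landed; nothing here is a claim about the Yang–Mills mass gap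

**Citation header (reproduction of PUBLISHED work).** V. F. Müller, J. Schiemann, *Continuum limit of a hierarchical
SU(2) lattice gauge theory in 4 dimensions*, Commun. Math. Phys. **110** (1987) 261–286, doi 10.1007/BF01207367
[MullerSchiemann1987], Sect. 2 «General Properties of the Analytically Continued Gibbs Factors» pp. 263–266 and
Sect. 3 p. 266, hypothesis (A₁). Loci `p.NNN L.nn` = journal page and text-layer line of the held Project Euclid scan
`paper:url-96df5da18d4c` (PDF page = journal page − 260). The displays (2.15)–(2.21), (3.1)–(3.5) and (A₁) were read on
the page renders filed by the lit-balaban YM LIT SWEEP fit-ref B (`inprint/lit-balaban-p18/renders-cmp110ms/g43/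
hierSU2-1987-cmp110-p005-x2.png`, `…/hierSU2-1987-cmp110-p006-x2.png`); the displays (2.1)–(2.12) of pp. 263–264 are
legible in the text layer except (2.4), (2.6)–(2.7), (2.10), (2.13)–(2.14), whose content is fixed by the surrounding
prose (quoted below) and by (2.16)–(2.17) p.265 (render) — declared where used. Sixth file of `MullerSchiemann1987/`;
continuation of `MS87HeatKernelSU2` (§9: `g_HK` on the group, (2.1)–(2.3)) and `MS87HeatKernelComplex` (`hC` = the
Gibbs factor `h` of (A.1) as an entire function of the complex angle), same namespace `…MullerSchiemann1987.HeatKernel`.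
Lean lane of the lit-balaban YM LIT SWEEP CONTEXT row X1 (register level, zero weight for any token of that table).

**What the paper prints (verbatim; text layer for prose, renders for displays).**
* p.263 L.29–37: *«The Gibbs factor … after n iterations … is denoted by g^{(n)}(u). It is a real valued,
  positive function of u ∈ G and has the following properties … g^{(n)}(e₀) = 1, (2.1) g^{(n)}(vuv⁻¹) = g^{(n)}(u), (2.2)
  g^{(n)}(u⁻¹) = g^{(n)}(u), (2.3)»*; p.264 L.2–3: *«In (2.4) we introduced an additional translation on the group in
  the "direction" given by the diagonal Pauli matrix σ₃, with x ∈ ℝ.»*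
* p.264 L.7–12: *«we proved inductively in (I) … that the functions g̃^{(n)}(u, x) := g^{(n)}(e^{−ixσ₃}u), n ∈ ℕ₀ (2.6)
  can be analytically continued: [(2.7): x ↦ z ∈ ℂ] and the functions g̃^{(n)}(u, z) are (i) continuous in u for fixed
  z ∈ ℂ, (ii) entire and real analytic in z ∈ ℂ for fixed u ∈ G.»* ((2.6) itself is garbled in the text layer; its
  content is restated legibly as (2.16) p.265: *«g̃^{(n)}(u, x) = g^{(n)}(e^{−ixσ₃}u) = g^{(n)}(e^{−iθσ₃}) = h^{(n)}(θ) (2.16)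
  with the central angle θ and its complement θ̌ = π − θ given by cos θ = u₀ cos x + u₃ sin x = −cos θ̌. (2.17)»*,
  for u parametrized as p.264 L.28–30 *«u = u₀σ₀ + iu·σ with {u₀, u} ∈ S³, the unit matrix σ₀ and the Pauli matrices
  σ_k»*.)
* p.264 L.13–27: *«From these properties we can furthermore infer the following functional relations, with u ∈ G,
  z ∈ ℂ, x′ ∈ ℝ, g̃^{(n)}(e^{−ix′σ₃}u, z) = g̃^{(n)}(u, x′ + z), (2.8)  g̃^{(n)}(u, z) = g̃^{(n)}(u⁻¹, −z). (2.9) … In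
  particular the functions [(2.10): h^{(n)}(z) := g̃^{(n)}(e₀, z), cf. (2.16)] are entire holomorphic in z ∈ ℂ, periodic
  with period 2π and even functions due to (2.9), h^{(n)}(z + π) = h^{(n)}(z − π), (2.11)  h^{(n)}(z) = h^{(n)}(−z).
  (2.12) The functions h^{(n)}(x) are the Gibbs factors, which are class functions, (2.2), expressed in terms of the
  central angle.»*
* p.265 (2.20) – p.266 L.9: *«Besides the Wilson action (2.5) we consider the heat kernel action (HK) in the initial
  Gibbs factor g_HK^{(0)}(u) = 𝒩 Σ_{j=0,½,1,…} (2j+1) e^{−(j+½)²/γ} χ_j(u), (2.20) with γ ∈ ℝ₊, the characters χ_j of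
  SU(2) and a normalization factor 𝒩 fixed by (2.1). … Expressing the characters χ_j(u) as polynomials of trace u,
  [12], the analytic continuation of (2.20) is given by
  g̃_HK^{(0)}(u, z) = 𝒩 Σ_{l=1}^∞ l e^{−l²/(4γ)} Σ_{k=0}^{[(l−1)/2]} (−1)^k binom(l−1−k, k) {trace(e^{−izσ₃}u)}^{l−1−2k}.
  (2.21) For a ∈ ℝ₊ we denoted by [a] the integer part of a. A little exercise shows that g̃_HK^{(0)}(u, z) is for
  fixed u an entire holomorphic function of z ∈ ℂ.»*
* p.266, Sect. 3: *«(A₁) General Properties. g̃(u, z) is continuous in u ∈ G for fixed z ∈ ℂ and entire holomorphic in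
  z for fixed u. Moreover g(u) = g̃(u, 0) is real and positive, satisfying (2.1)–(2.3).»*

**What is reproduced here (kernel-checked: zero `sorry`, zero named facts, axioms standard).**
* §1 — the character series as an ENTIRE FUNCTION OF THE HALF-TRACE: `hTr γ c = 𝒩 Σ_{l≥0} (l+1)e^{−(l+1)²/(4γ)} U_l(c)`,
  `c ∈ ℂ` (`U_l` = Chebyshev polynomial of the second kind; `χ_{l/2}(u) = U_l(½ tr u)`); `differentiable_hTr` (entire,
  locally uniform convergence on discs from `‖U_l(c)‖ ≤ (1 + 2‖c‖)^l`), `hC_eq_hTr_cos` (`hC γ θ = hTr γ (cos θ)`: the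
  Appendix function of `MS87HeatKernelComplex` IS this series at `c = cos θ`), `hTr_ofReal` (real on `ℝ`),
  `hTrReal_cos` (`= h γ θ` of `MS87HeatKernelSU2`), `gHK_eq_hTrReal` (**`g_HK(u) = hTr(½ tr u)`** on `SU(2)`, i.e. (2.20)).
* §2 — `SU(2)` bookkeeping (Mathlib's `Matrix.specialUnitaryGroup (Fin 2) ℂ`; `u₁₁ = ū₀₀`, `u₁₀ = −ū₀₁` BY NAME from
  the tree's `QuantumLattice.SU2Haar`, `su2_apply_11` / `su2_apply_10`): `tr u = 2 Re u₀₀`,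
  the parameters `u₀ = Re u₀₀`, `u₃ = Im u₀₀` of p.264 with `u₀² + u₃² ≤ 1`; the one-parameter subgroup
  `diagPhase x = e^{−ixσ₃} = diag(e^{−ix}, e^{ix})` («translation on the group in the direction σ₃», p.264 L.2–3) with
  `diagPhase_add`, `diagPhase_zero`, and **(2.17)**: `u₀(e^{−ixσ₃}u) = u₀ cos x + u₃ sin x` (`u0_diagPhase_mul`).
* §3 — **`g̃_HK(u, z) := hTr(u₀ cos z + u₃ sin z)`** (`gTildeHK`) and, for it: **(2.6)/(2.16)** `g̃_HK(u, x) = g_HK(e^{−ixσ₃}u)`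
  for real `x` (`gTildeHK_ofReal`); **(A₁)/(2.7)(ii)** `z ↦ g̃_HK(u, z)` is ENTIRE (`differentiable_gTildeHK`) and real on
  `ℝ` (`gTildeHK_im_ofReal`); **(A₁)/(2.7)(i)** `u ↦ g̃_HK(u, z)` is continuous (`continuous_gTildeHK_left`);
  `g̃_HK(u, 0) = g_HK(u)` (`gTildeHK_zero`) which is real, positive and satisfies (2.1)–(2.3) (`MS87HeatKernelSU2` §9);
  **(2.8)** `gTildeHK_diagPhase_mul`; **(2.9)** `gTildeHK_inv_neg`; **(2.10)** `g̃_HK(e₀, z) = h(z)` = `hC γ z`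
  (`gTildeHK_one`); **(2.11)** `hC_add_pi_eq_sub_pi`; (2.12) is `MS87HeatKernelComplex.hC_neg`; the bundle `A1_heatKernel`.
* §4 — **(2.21) AS PRINTED**: the binomial form `U_n(t/2) = Σ_{k=0}^{[n/2]} (−1)^k binom(n−k, k) t^{n−2k}` of the
  characters as polynomials of the trace (`U_eval_half_eq_binomSum`, via Mathlib's rescaled Chebyshev polynomials
  `S_n`, `S_n(t) = U_n(t/2)`, and the two-step recursion), `trace(e^{−izσ₃}u) = e^{−iz}u₀₀ + e^{iz}u₁₁ =
  2(u₀ cos z + u₃ sin z)` (`tracePhase_eq`), and **`gTildeHK_eq_printed`**: `g̃_HK(u, z) = 𝒩 Σ_{l≥1} l e^{−l²/(4γ)}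
  Σ_{k=0}^{[(l−1)/2]} (−1)^k binom(l−1−k, k) {trace(e^{−izσ₃}u)}^{l−1−2k}` (index `l ≥ 1` written as `l + 1`, `l ∈ ℕ`).

**Readings (declared).** (a) The paper's (2.6)–(2.7) define `g̃` for a general iterate `g^{(n)}` as THE analytic
continuation of `x ↦ g^{(n)}(e^{−ixσ₃}u)`; for the heat-kernel action the paper gives this continuation explicitly as
(2.21), and `gTildeHK` is (2.21) summed in closed form (`gTildeHK_eq_printed`); that it agrees with `g_HK(e^{−ixσ₃}u)`
for real `x` is `gTildeHK_ofReal`, and an entire function is determined by its real restriction, so nothing is lost.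
(b) «real analytic in z» is read as: entire and real-valued on the real axis. (c) `σ₃ = diag(1, −1)`, so
`e^{−ixσ₃} = diag(e^{−ix}, e^{ix})` and `(e^{−ixσ₃}u)₀₀ = e^{−ix}u₀₀`; `u₀ = Re u₀₀ = ½ tr u`, `u₃ = Im u₀₀`. (d) The
characters «as polynomials of trace u, [12]» are `χ_j(u) = U_{2j}(½ tr u)`; (2.21)'s inner sum is `U_{l−1}(t/2)`
expanded, which §4 proves rather than assumes. (e) The displays (2.6), (2.7), (2.10) are garbled in the text layer
and no render of p.264 was available to this seat: (2.6) is read off its legible restatement (2.16) p.265 (render);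
(2.7) as «x ↦ z ∈ ℂ» per the sentence around it (L.7–12); (2.10) — consistently with (2.16) `g(e^{−iθσ₃}) = h(θ)` and
with p.264 L.26–27 — as `h^{(n)}(z) = g̃^{(n)}(e₀, z)`.

**Not claimed.** Anything about the Wilson action (2.5) or a general iterate `g^{(n)}` ((2.6)–(2.12) are proved here
for the heat-kernel initial factor only — for general `n` they are the content of (I) = ref. [8]); Proposition 1
((2.13)–(2.15): the central angle `θ(u, z)` as a holomorphic function and `g̃ = h(θ)` for complex `z`); the recursion
(2.4)/(3.1); (A₂), (A₃), Theorem 1; lattice Yang–Mills.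
-/

noncomputable section

open Real Filter Topology Set

namespace Literature.MathematicalPhysics.QuantumFieldTheory

namespace MullerSchiemann1987

namespace HeatKernel

/-! ## §1 The character series as an entire function of the half-trace `c = ½ tr u` -/

section HalfTrace

variable {γ : ℝ}

/-- `‖U_l(c)‖ ≤ (1 + 2‖c‖)^l` for the Chebyshev polynomials of the second kind (recurrence
`U_{l+2} = 2X·U_{l+1} − U_l`; as in `MS87HeatKernelComplex`, where it is private). [folklore] -/
private theorem norm_chebyshevU_eval_le' (c : ℂ) (l : ℕ) :
    ‖(Polynomial.Chebyshev.U ℂ l).eval c‖ ≤ (1 + 2 * ‖c‖) ^ l := by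
  set M : ℝ := 1 + 2 * ‖c‖ with hM
  have hM1 : 1 ≤ M := by rw [hM]; linarith [norm_nonneg c]
  induction l using Nat.twoStepInduction with
  | zero => simp
  | one =>
    simp only [Nat.cast_one, Polynomial.Chebyshev.U_one, Polynomial.eval_mul, Polynomial.eval_ofNat,
      Polynomial.eval_X, pow_one, norm_mul, Complex.norm_two]
    linarith [norm_nonneg c]
  | more l h0 h1 =>
    have hrec : Polynomial.Chebyshev.U ℂ ((l + 2 : ℕ) : ℤ) =
        2 * Polynomial.X * Polynomial.Chebyshev.U ℂ ((l + 1 : ℕ) : ℤ) - Polynomial.Chebyshev.U ℂ (l : ℤ) := by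
      have := Polynomial.Chebyshev.U_add_two ℂ (l : ℤ)
      push_cast at this ⊢
      exact this
    rw [hrec, Polynomial.eval_sub, Polynomial.eval_mul, Polynomial.eval_mul, Polynomial.eval_ofNat,
      Polynomial.eval_X]
    calc ‖2 * c * Polynomial.eval c (Polynomial.Chebyshev.U ℂ ((l + 1 : ℕ) : ℤ)) -
          Polynomial.eval c (Polynomial.Chebyshev.U ℂ (l : ℤ))‖
        ≤ ‖2 * c * Polynomial.eval c (Polynomial.Chebyshev.U ℂ ((l + 1 : ℕ) : ℤ))‖ +
          ‖Polynomial.eval c (Polynomial.Chebyshev.U ℂ (l : ℤ))‖ := norm_sub_le _ _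
      _ ≤ 2 * ‖c‖ * M ^ (l + 1) + M ^ l := by
          rw [norm_mul, norm_mul, Complex.norm_two]
          gcongr
      _ ≤ 2 * ‖c‖ * M ^ (l + 1) + M ^ (l + 1) := by
          have : M ^ l ≤ M ^ (l + 1) := pow_le_pow_right₀ hM1 (Nat.le_succ l)
          linarith
      _ = M ^ (l + 2) := by rw [hM]; ring

/-- The coefficients `c_l = (l+1) q^{(l+1)²}` against a geometric weight `M^l` are summable (`0 < q < 1`, ratio test;
as in `MS87HeatKernelComplex`, where it is private). [folklore] -/
private theorem summable_coef_mul_pow' {q : ℝ} (hq0 : 0 < q) (hq1 : q < 1) {M : ℝ} (hM : 0 < M) :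
    Summable fun l : ℕ => ((l : ℝ) + 1) * q ^ ((l + 1) ^ 2) * M ^ l := by
  refine summable_of_ratio_norm_eventually_le (r := 1 / 2) (by norm_num) ?_
  have hq : Tendsto (fun n : ℕ => q ^ n) atTop (𝓝 0) := tendsto_pow_atTop_nhds_zero_of_lt_one hq0.le hq1
  have hev : ∀ᶠ n : ℕ in atTop, q ^ n < 1 / (4 * M) :=
    hq.eventually (gt_mem_nhds (by positivity))
  filter_upwards [hev] with l hl
  have hpos : 0 < ((l : ℝ) + 1) * q ^ ((l + 1) ^ 2) * M ^ l := by positivity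
  rw [Real.norm_of_nonneg (by positivity), Real.norm_of_nonneg hpos.le]
  have hexp : q ^ ((l + 1 + 1) ^ 2) = q ^ ((l + 1) ^ 2) * q ^ (2 * l + 3) := by
    rw [← pow_add]; congr 1; ring
  have hql : q ^ (2 * l + 3) ≤ q ^ l := pow_le_pow_of_le_one hq0.le hq1.le (by omega)
  have h2 : ((l : ℝ) + 1 + 1) ≤ 2 * ((l : ℝ) + 1) := by linarith [(Nat.cast_nonneg l : (0 : ℝ) ≤ l)]
  push_cast
  rw [hexp, pow_succ]
  have hA : 0 ≤ q ^ ((l + 1) ^ 2) := by positivity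
  have hB : 0 ≤ M ^ l := by positivity
  have hqM : q ^ (2 * l + 3) * M ≤ 1 / 4 := by
    calc q ^ (2 * l + 3) * M ≤ q ^ l * M := by gcongr
      _ ≤ 1 / (4 * M) * M := by gcongr
      _ = 1 / 4 := by field_simp
  calc ((l : ℝ) + 1 + 1) * (q ^ ((l + 1) ^ 2) * q ^ (2 * l + 3)) * (M ^ l * M)
      = ((l : ℝ) + 1 + 1) * (q ^ (2 * l + 3) * M) * (q ^ ((l + 1) ^ 2) * M ^ l) := by ring
    _ ≤ (2 * ((l : ℝ) + 1)) * (1 / 4) * (q ^ ((l + 1) ^ 2) * M ^ l) := by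
        gcongr
    _ = 1 / 2 * (((l : ℝ) + 1) * q ^ ((l + 1) ^ 2) * M ^ l) := by ring

/-- The `l`-th term of (2.20)/(A.1) as a function of the half-trace: `c_l · U_l(c)`, `c_l = (l+1)e^{−(l+1)²/(4γ)}`
(`χ_{l/2}(u) = U_l(½ tr u)`). [cite: MullerSchiemann1987, (2.20)–(2.21) pp.265–266] -/
def termU (γ : ℝ) (l : ℕ) (c : ℂ) : ℂ :=
  (coefA1 γ l : ℂ) * (Polynomial.Chebyshev.U ℂ (l : ℤ)).eval c

/-- **The heat-kernel Gibbs factor as a function of the (complex) half-trace**: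
`hTr γ c = 𝒩 Σ_{l≥0} (l+1) e^{−(l+1)²/(4γ)} U_l(c)` — (2.20) with the characters written as polynomials of the trace,
i.e. the closed form of (2.21) before substituting `c = ½ trace(e^{−izσ₃}u)`. [cite: MullerSchiemann1987, (2.20)–(2.21) pp.265–266] -/
def hTr (γ : ℝ) (c : ℂ) : ℂ := (normN γ : ℂ) * ∑' l : ℕ, termU γ l c

/-- The Appendix series (A.1) at the complex angle `θ` is the half-trace series at `c = cos θ`, termwise.
[cite: MullerSchiemann1987, (2.16), (2.20) p.265] -/
theorem termC_eq_termU (γ : ℝ) (l : ℕ) (θ : ℂ) : termC γ l θ = termU γ l (Complex.cos θ) := rfl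

/-- **`h(θ) = hTr(cos θ)`** for every complex `θ`: the Appendix function `hC` of `MS87HeatKernelComplex` is the
character series evaluated at the half-trace `cos θ` ((2.16): `g̃ = h(θ)` with `cos θ = ½ tr`).
[cite: MullerSchiemann1987, (2.16)–(2.17) p.265, (A.1) p.284] -/
theorem hC_eq_hTr_cos (γ : ℝ) (θ : ℂ) : hC γ θ = hTr γ (Complex.cos θ) := rfl

/-- Termwise bound on the disc `‖c‖ ≤ R`: `‖c_l U_l(c)‖ ≤ c_l (1 + 2R)^l` (the estimate behind «a little exercise shows
that g̃_HK … is … entire», p.266 L.8–9). [cite: MullerSchiemann1987, p.266 L.8–9] -/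
theorem norm_termU_le {R : ℝ} (l : ℕ) {c : ℂ} (hc : ‖c‖ ≤ R) :
    ‖termU γ l c‖ ≤ coefA1 γ l * (1 + 2 * R) ^ l := by
  unfold termU
  rw [norm_mul, Complex.norm_real, Real.norm_of_nonneg (coefA1_pos γ l).le]
  refine mul_le_mul_of_nonneg_left ?_ (coefA1_pos γ l).le
  refine (norm_chebyshevU_eval_le' _ _).trans ?_
  have h0 : 0 ≤ 1 + 2 * ‖c‖ := by positivity
  exact pow_le_pow_left₀ h0 (by linarith) l

/-- The majorant `Σ c_l M^l` converges for every `M > 0` (`γ > 0`). [cite: MullerSchiemann1987, p.266 L.8–9] -/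
theorem summable_coefA1_mul_geom (hγ : 0 < γ) {M : ℝ} (hM : 0 < M) :
    Summable fun l : ℕ => coefA1 γ l * M ^ l := by
  unfold coefA1
  exact summable_coef_mul_pow' (nome_pos γ) (nome_lt_one hγ) hM

/-- The series `Σ c_l U_l(c)` converges absolutely at every complex `c`. [cite: MullerSchiemann1987, p.266 L.8–9] -/
theorem summable_termU (hγ : 0 < γ) (c : ℂ) : Summable fun l : ℕ => termU γ l c :=
  Summable.of_norm_bounded (summable_coefA1_mul_geom hγ (by positivity : 0 < 1 + 2 * ‖c‖))
    fun l => norm_termU_le l le_rfl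

/-- Each term `c_l U_l(c)` is a polynomial, hence entire. [folklore] -/
private theorem differentiable_termU (γ : ℝ) (l : ℕ) : Differentiable ℂ (termU γ l) := by
  unfold termU
  exact (differentiable_const _).mul (Polynomial.Chebyshev.U ℂ (l : ℤ)).differentiable

/-- The series is differentiable on every disc `‖c‖ < R` (locally uniform convergence). [cite: MullerSchiemann1987, p.266 L.8–9] -/
theorem differentiableOn_tsum_termU (hγ : 0 < γ) (R : ℝ) :
    DifferentiableOn ℂ (fun c => ∑' l : ℕ, termU γ l c) (Metric.ball (0 : ℂ) R) := by
  refine Complex.differentiableOn_tsum_of_summable_norm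
    (summable_coefA1_mul_geom hγ (by positivity : 0 < 1 + 2 * |R|))
    (fun l => (differentiable_termU γ l).differentiableOn) Metric.isOpen_ball ?_
  intro l c hc
  rw [Metric.mem_ball, dist_zero_right] at hc
  exact norm_termU_le l (hc.le.trans (le_abs_self R))

/-- **`hTr` is entire** — the heart of «A little exercise shows that g̃_HK^{(0)}(u, z) is for fixed u an entire
holomorphic function of z ∈ ℂ» (p.266 L.8–9): the character series is an entire function of the half-trace.
[cite: MullerSchiemann1987, p.266 L.8–9; (A₁) p.266] -/
theorem differentiable_hTr (hγ : 0 < γ) : Differentiable ℂ (hTr γ) := by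
  intro c
  have hmem : c ∈ Metric.ball (0 : ℂ) (‖c‖ + 1) := by
    rw [Metric.mem_ball, dist_zero_right]; linarith
  have hd := (differentiableOn_tsum_termU hγ (‖c‖ + 1)).differentiableAt (Metric.isOpen_ball.mem_nhds hmem)
  exact (differentiableAt_const _).mul hd

/-- `hTr` is continuous. [cite: MullerSchiemann1987, (A₁) p.266] -/
theorem continuous_hTr (hγ : 0 < γ) : Continuous (hTr γ) := (differentiable_hTr hγ).continuous

/-- The same series with a real argument, real-valued: `hTrReal γ r = 𝒩 Σ (l+1)e^{−(l+1)²/(4γ)} U_l(r)`.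
[cite: MullerSchiemann1987, (2.20) p.265] -/
def hTrReal (γ : ℝ) (r : ℝ) : ℝ := normN γ * ∑' l : ℕ, coefA1 γ l * (Polynomial.Chebyshev.U ℝ (l : ℤ)).eval r

/-- On the real axis the terms are real: `c_l U_l(r)` with `U_l` evaluated over `ℝ` ((2.7)(ii) «real analytic»).
[cite: MullerSchiemann1987, (2.7) p.264, (2.20) p.265] -/
theorem termU_ofReal (γ : ℝ) (l : ℕ) (r : ℝ) :
    termU γ l (r : ℂ) = ((coefA1 γ l * (Polynomial.Chebyshev.U ℝ (l : ℤ)).eval r : ℝ) : ℂ) := by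
  have h := Polynomial.Chebyshev.algebraMap_eval_U (R := ℝ) (R' := ℂ) r (l : ℤ)
  rw [Complex.coe_algebraMap] at h
  unfold termU
  rw [Complex.ofReal_mul, h]

/-- **`hTr` is real on the real axis**: `hTr γ r = hTrReal γ r` for real `r` («real analytic», (2.7)(ii)).
[cite: MullerSchiemann1987, (2.7) p.264] -/
theorem hTr_ofReal (γ : ℝ) (r : ℝ) : hTr γ (r : ℂ) = ((hTrReal γ r : ℝ) : ℂ) := by
  unfold hTr hTrReal
  rw [Complex.ofReal_mul, Complex.ofReal_tsum]
  congr 1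
  exact tsum_congr fun l => termU_ofReal γ l r

/-- The imaginary part of `hTr` vanishes on the real axis. [cite: MullerSchiemann1987, (2.7) p.264] -/
theorem hTr_ofReal_im (γ : ℝ) (r : ℝ) : (hTr γ (r : ℂ)).im = 0 := by
  rw [hTr_ofReal, Complex.ofReal_im]

/-- **`hTrReal γ (cos θ) = h γ θ`**: the half-trace series at `cos θ` is the Gibbs factor of (A.1) in the central angle
(`MS87HeatKernelSU2.h`). [cite: MullerSchiemann1987, (2.16) p.265, (A.1) p.284] -/
theorem hTrReal_cos (hγ : 0 < γ) (θ : ℝ) : hTrReal γ (Real.cos θ) = h γ θ := by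
  have h1 : hC γ (θ : ℂ) = ((h γ θ : ℝ) : ℂ) := hC_ofReal hγ θ
  rw [hC_eq_hTr_cos, ← Complex.ofReal_cos, hTr_ofReal] at h1
  exact_mod_cast h1

/-- `hTr γ (cos θ) = h γ θ` (complex form). [cite: MullerSchiemann1987, (2.16) p.265] -/
theorem hTr_cos_ofReal (hγ : 0 < γ) (θ : ℝ) : hTr γ ((Real.cos θ : ℝ) : ℂ) = ((h γ θ : ℝ) : ℂ) := by
  rw [hTr_ofReal, hTrReal_cos hγ]

/-- For `r ∈ [−1, 1]`: `hTrReal γ r = h γ (arccos r)`. [cite: MullerSchiemann1987, (2.16)–(2.17) p.265] -/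
theorem hTrReal_eq_h_arccos (hγ : 0 < γ) {r : ℝ} (h1 : -1 ≤ r) (h2 : r ≤ 1) :
    hTrReal γ r = h γ (Real.arccos r) := by
  rw [← hTrReal_cos hγ, Real.cos_arccos h1 h2]

/-- `hTr 1 = 1` (the unit element: `½ tr e₀ = 1`, (2.1)). [cite: MullerSchiemann1987, (2.1) p.263] -/
theorem hTr_one (hγ : 0 < γ) : hTr γ 1 = 1 := by
  have := hTr_cos_ofReal hγ 0
  rwa [Real.cos_zero, h_zero hγ, Complex.ofReal_one] at this

end HalfTrace

/-! ## §2 `SU(2)`: entries, the parameters `u₀`, `u₃`, and the subgroup `e^{−ixσ₃}` -/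

section OnTheGroupHK

variable {γ : ℝ}

/-- The group `G = SU(2)` as Mathlib's special unitary `2 × 2` complex matrices. -/
local notation "SU2" => Matrix.specialUnitaryGroup (Fin 2) ℂ

/-- `u u* = 1` for `u ∈ G = SU(2)` (plumbing). [folklore] -/
private theorem val_mul_star_val (U : SU2) :
    (U : Matrix (Fin 2) (Fin 2) ℂ) * star (U : Matrix (Fin 2) (Fin 2) ℂ) = 1 := U.prop.1.2

/-- `|u₀₀|² + |u₀₁|² = 1` (first row of `u u* = 1`). [cite: MullerSchiemann1987, p.264 L.29 «{u₀, u} ∈ S³»] -/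
theorem normSq_add_normSq (U : SU2) :
    Complex.normSq ((U : Matrix (Fin 2) (Fin 2) ℂ) 0 0) + Complex.normSq ((U : Matrix (Fin 2) (Fin 2) ℂ) 0 1) = 1 := by
  have h := congrFun (congrFun (val_mul_star_val U) 0) 0
  rw [Matrix.mul_apply, Fin.sum_univ_two, Matrix.star_apply, Matrix.star_apply, Matrix.one_apply_eq] at h
  have h' : (Complex.normSq ((U : Matrix (Fin 2) (Fin 2) ℂ) 0 0) : ℂ) +
      (Complex.normSq ((U : Matrix (Fin 2) (Fin 2) ℂ) 0 1) : ℂ) = 1 := by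
    rw [← Complex.mul_conj, ← Complex.mul_conj]
    exact h
  exact_mod_cast h'

/-- The parameter `u₀ = Re u₀₀ = ½ tr u` of `u = u₀σ₀ + iu·σ`. [cite: MullerSchiemann1987, p.264 L.28–30] -/
def u0 (U : SU2) : ℝ := ((U : Matrix (Fin 2) (Fin 2) ℂ) 0 0).re

/-- The parameter `u₃ = Im u₀₀` of `u = u₀σ₀ + iu·σ` (`σ₃ = diag(1, −1)`). [cite: MullerSchiemann1987, p.264 L.28–30] -/
def u3 (U : SU2) : ℝ := ((U : Matrix (Fin 2) (Fin 2) ℂ) 0 0).im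

/-- `u₀₀ = u₀ + iu₃`. [cite: MullerSchiemann1987, p.264 L.28–30] -/
theorem val_zero_zero_eq (U : SU2) :
    (U : Matrix (Fin 2) (Fin 2) ℂ) 0 0 = (u0 U : ℂ) + (u3 U : ℂ) * Complex.I := by
  rw [u0, u3]; exact (Complex.re_add_im _).symm

/-- **`tr u = 2u₀`** (real): `tr u = u₀₀ + ū₀₀`. [cite: MullerSchiemann1987, p.264 L.28–30, (2.17) p.265] -/
theorem trace_val_eq (U : SU2) : Matrix.trace (U : Matrix (Fin 2) (Fin 2) ℂ) = 2 * (u0 U : ℂ) := by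
  rw [Matrix.trace_fin_two, QuantumLattice.su2_apply_11, Complex.add_conj, u0]
  push_cast
  ring

/-- `Re(tr u)/2 = u₀`. [cite: MullerSchiemann1987, (2.17) p.265] -/
theorem trace_re_div_two (U : SU2) : (Matrix.trace (U : Matrix (Fin 2) (Fin 2) ℂ)).re / 2 = u0 U := by
  rw [trace_val_eq]
  simp

/-- `u₀² + u₃² ≤ 1` (`= |u₀₀|² = 1 − |u₀₁|²`). [cite: MullerSchiemann1987, p.264 L.29] -/
theorem u0_sq_add_u3_sq_le_one (U : SU2) : u0 U ^ 2 + u3 U ^ 2 ≤ 1 := by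
  have h := normSq_add_normSq U
  have h2 : 0 ≤ Complex.normSq ((U : Matrix (Fin 2) (Fin 2) ℂ) 0 1) := Complex.normSq_nonneg _
  rw [Complex.normSq_apply] at h
  rw [u0, u3]
  nlinarith [h, h2]

/-- `−1 ≤ u₀ ≤ 1`. [cite: MullerSchiemann1987, p.264 L.29] -/
theorem abs_u0_le_one (U : SU2) : |u0 U| ≤ 1 := by
  have h := u0_sq_add_u3_sq_le_one U
  rw [abs_le]
  constructor <;> nlinarith [sq_nonneg (u3 U), sq_nonneg (u0 U + 1), sq_nonneg (u0 U - 1)]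

/-- The central angle of `MS87HeatKernelSU2` is `arccos u₀`. [cite: MullerSchiemann1987, (2.13), (2.17) pp.264–265] -/
theorem centralAngle_eq_arccos_u0 (U : SU2) : centralAngle U = Real.arccos (u0 U) := by
  rw [centralAngle, trace_re_div_two]

/-- **(2.20) via the trace: `g_HK(u) = hTr(½ tr u) = hTr(u₀)`** — the heat-kernel Gibbs factor of
`MS87HeatKernelSU2` (§9, `gHK γ u = h γ (θ(u))`) is the character series at the half-trace.
[cite: MullerSchiemann1987, (2.20)–(2.21) pp.265–266] -/
theorem gHK_eq_hTrReal (hγ : 0 < γ) (U : SU2) : gHK γ U = hTrReal γ (u0 U) := by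
  have hb := abs_le.mp (abs_u0_le_one U)
  rw [gHK, centralAngle_eq_arccos_u0, hTrReal_eq_h_arccos hγ hb.1 hb.2]

/-- Complex form: `(g_HK(u) : ℂ) = hTr(u₀)`. [cite: MullerSchiemann1987, (2.20)–(2.21) pp.265–266] -/
theorem gHK_eq_hTr (hγ : 0 < γ) (U : SU2) : ((gHK γ U : ℝ) : ℂ) = hTr γ (u0 U : ℂ) := by
  rw [hTr_ofReal, gHK_eq_hTrReal hγ]

/-- `u₀(u⁻¹) = u₀(u)` (`(u⁻¹)₀₀ = (u*)₀₀ = ū₀₀`). [cite: MullerSchiemann1987, (2.3), (2.9) p.264] -/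
theorem u0_inv (U : SU2) : u0 U⁻¹ = u0 U := by
  rw [u0, u0, ← Matrix.star_eq_inv, Matrix.specialUnitaryGroup.coe_star, Matrix.star_apply, Complex.star_def,
    Complex.conj_re]

/-- `u₃(u⁻¹) = −u₃(u)`. [cite: MullerSchiemann1987, (2.9) p.264] -/
theorem u3_inv (U : SU2) : u3 U⁻¹ = -u3 U := by
  rw [u3, u3, ← Matrix.star_eq_inv, Matrix.specialUnitaryGroup.coe_star, Matrix.star_apply, Complex.star_def,
    Complex.conj_im]

/-- `u₀(e₀) = 1`. [cite: MullerSchiemann1987, (2.1) p.263] -/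
theorem u0_one : u0 (1 : SU2) = 1 := by
  rw [u0, OneMemClass.coe_one, Matrix.one_apply_eq, Complex.one_re]

/-- `u₃(e₀) = 0`. [cite: MullerSchiemann1987, (2.1) p.263] -/
theorem u3_one : u3 (1 : SU2) = 0 := by
  rw [u3, OneMemClass.coe_one, Matrix.one_apply_eq, Complex.one_im]

/-- `u ↦ u₀` is continuous (enters (A₁): continuity of `g̃` in `u`). [cite: MullerSchiemann1987, (A₁) p.266] -/
theorem continuous_u0 : Continuous (u0 : SU2 → ℝ) :=
  Complex.continuous_re.comp (continuous_subtype_val.matrix_elem 0 0)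

/-- `u ↦ u₃` is continuous (enters (A₁): continuity of `g̃` in `u`). [cite: MullerSchiemann1987, (A₁) p.266] -/
theorem continuous_u3 : Continuous (u3 : SU2 → ℝ) :=
  Complex.continuous_im.comp (continuous_subtype_val.matrix_elem 0 0)

/-- The phase `e^{ix}` has modulus one: `e^{ix} · conj(e^{ix}) = 1`. [folklore] -/
private theorem exp_mul_I_mul_conj (x : ℝ) :
    Complex.exp ((x : ℂ) * Complex.I) * (starRingEnd ℂ) (Complex.exp ((x : ℂ) * Complex.I)) = 1 := by
  rw [Complex.mul_conj, Complex.normSq_eq_norm_sq, Complex.norm_exp_ofReal_mul_I]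
  simp

/-- … and `e^{−ix} · conj(e^{−ix}) = 1`. [folklore] -/
private theorem exp_neg_mul_I_mul_conj (x : ℝ) :
    Complex.exp (-((x : ℂ) * Complex.I)) * (starRingEnd ℂ) (Complex.exp (-((x : ℂ) * Complex.I))) = 1 := by
  have h := exp_mul_I_mul_conj (-x)
  push_cast at h
  rwa [neg_mul] at h

/-- `e^{−ix} e^{ix} = 1`. [folklore] -/
private theorem exp_neg_mul_exp (x : ℝ) :
    Complex.exp (((-x : ℝ) : ℂ) * Complex.I) * Complex.exp ((x : ℂ) * Complex.I) = 1 := by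
  rw [← Complex.exp_add]
  push_cast
  ring_nf
  exact Complex.exp_zero

/-- **The one-parameter subgroup `e^{−ixσ₃} = diag(e^{−ix}, e^{ix}) ⊂ SU(2)`**, `x ∈ ℝ` — «an additional translation on
the group in the "direction" given by the diagonal Pauli matrix σ₃» (p.264 L.2–3; `σ₃ = diag(1, −1)`).
[cite: MullerSchiemann1987, (2.4), (2.6) p.264] -/
def diagPhase (x : ℝ) : SU2 :=
  ⟨!![Complex.exp (((-x : ℝ) : ℂ) * Complex.I), 0; 0, Complex.exp ((x : ℂ) * Complex.I)], by
    rw [Matrix.mem_specialUnitaryGroup_iff, Matrix.mem_unitaryGroup_iff]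
    refine ⟨?_, ?_⟩
    · ext i j
      fin_cases i <;> fin_cases j <;>
        simp [Matrix.mul_apply, Fin.sum_univ_two, Matrix.star_apply, exp_mul_I_mul_conj, exp_neg_mul_I_mul_conj]
    · rw [Matrix.det_fin_two_of, mul_zero, sub_zero, exp_neg_mul_exp]⟩

/-- The matrix of `e^{−ixσ₃}`. [cite: MullerSchiemann1987, (2.6) p.264] -/
theorem coe_diagPhase (x : ℝ) :
    ((diagPhase x : SU2) : Matrix (Fin 2) (Fin 2) ℂ) =
      !![Complex.exp (((-x : ℝ) : ℂ) * Complex.I), 0; 0, Complex.exp ((x : ℂ) * Complex.I)] := rfl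

/-- `e^{−i·0·σ₃} = e₀`. [cite: MullerSchiemann1987, (2.6) p.264] -/
theorem diagPhase_zero : diagPhase 0 = 1 := by
  apply Subtype.ext
  rw [coe_diagPhase, OneMemClass.coe_one]
  ext i j
  fin_cases i <;> fin_cases j <;> simp

/-- `e^{−i(x+y)σ₃} = e^{−ixσ₃} e^{−iyσ₃}` (a one-parameter subgroup). [cite: MullerSchiemann1987, (2.8) p.264] -/
theorem diagPhase_add (x y : ℝ) : diagPhase (x + y) = diagPhase x * diagPhase y := by
  apply Subtype.ext
  rw [Submonoid.coe_mul, coe_diagPhase, coe_diagPhase, coe_diagPhase]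
  ext i j
  fin_cases i <;> fin_cases j <;> simp [Matrix.mul_apply, Fin.sum_univ_two, ← Complex.exp_add] <;> ring_nf

/-- The `(0,0)` entry of `e^{−ixσ₃}u` is `e^{−ix}u₀₀`. [cite: MullerSchiemann1987, (2.16)–(2.17) p.265] -/
theorem coe_diagPhase_mul_apply_zero_zero (x : ℝ) (U : SU2) :
    ((diagPhase x * U : SU2) : Matrix (Fin 2) (Fin 2) ℂ) 0 0 =
      Complex.exp (((-x : ℝ) : ℂ) * Complex.I) * (U : Matrix (Fin 2) (Fin 2) ℂ) 0 0 := by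
  rw [Submonoid.coe_mul, coe_diagPhase, Matrix.mul_apply, Fin.sum_univ_two]
  simp

/-- **(2.17)**: `u₀(e^{−ixσ₃}u) = u₀ cos x + u₃ sin x` — «cos θ = u₀ cos x + u₃ sin x».
[cite: MullerSchiemann1987, (2.17) p.265] -/
theorem u0_diagPhase_mul (x : ℝ) (U : SU2) :
    u0 (diagPhase x * U) = u0 U * Real.cos x + u3 U * Real.sin x := by
  rw [u0, coe_diagPhase_mul_apply_zero_zero, val_zero_zero_eq, Complex.exp_mul_I, ← Complex.ofReal_cos,
    ← Complex.ofReal_sin, Real.cos_neg, Real.sin_neg, Complex.ofReal_neg]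
  simp only [Complex.mul_re, Complex.add_re, Complex.add_im, Complex.mul_im, Complex.ofReal_re,
    Complex.ofReal_im, Complex.I_re, Complex.I_im, Complex.neg_re, Complex.neg_im]
  ring

/-- The companion of (2.17): `u₃(e^{−ixσ₃}u) = u₃ cos x − u₀ sin x`. [cite: MullerSchiemann1987, (2.17) p.265] -/
theorem u3_diagPhase_mul (x : ℝ) (U : SU2) :
    u3 (diagPhase x * U) = u3 U * Real.cos x - u0 U * Real.sin x := by
  rw [u3, coe_diagPhase_mul_apply_zero_zero, val_zero_zero_eq, Complex.exp_mul_I, ← Complex.ofReal_cos,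
    ← Complex.ofReal_sin, Real.cos_neg, Real.sin_neg, Complex.ofReal_neg]
  simp only [Complex.mul_re, Complex.add_re, Complex.add_im, Complex.mul_im, Complex.ofReal_re,
    Complex.ofReal_im, Complex.I_re, Complex.I_im, Complex.neg_re, Complex.neg_im]
  ring

/-! ## §3 The analytically continued heat-kernel Gibbs factor `g̃_HK(u, z)`; (2.6)–(2.12) and (A₁) for it -/

/-- **`g̃_HK(u, z) := hTr(u₀ cos z + u₃ sin z)`**, `u ∈ SU(2)`, `z ∈ ℂ` — the analytic continuation (2.7) of
`x ↦ g_HK(e^{−ixσ₃}u)` (2.6), given for the heat-kernel action by (2.21) (`gTildeHK_eq_printed`, §4) since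
`½ trace(e^{−izσ₃}u) = u₀ cos z + u₃ sin z`. [cite: MullerSchiemann1987, (2.6)–(2.7) p.264, (2.16)–(2.17) p.265, (2.21) p.266] -/
def gTildeHK (γ : ℝ) (U : SU2) (z : ℂ) : ℂ :=
  hTr γ ((u0 U : ℂ) * Complex.cos z + (u3 U : ℂ) * Complex.sin z)

/-- **(2.6)/(2.16)**: for REAL `x`, `g̃_HK(u, x) = g_HK(e^{−ixσ₃}u)` — the continued function restricts to the translated
Gibbs factor on the group. [cite: MullerSchiemann1987, (2.6) p.264, (2.16)–(2.17) p.265] -/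
theorem gTildeHK_ofReal (hγ : 0 < γ) (U : SU2) (x : ℝ) :
    gTildeHK γ U (x : ℂ) = ((gHK γ (diagPhase x * U) : ℝ) : ℂ) := by
  rw [gHK_eq_hTr hγ, u0_diagPhase_mul, gTildeHK, ← Complex.ofReal_cos, ← Complex.ofReal_sin]
  push_cast
  ring_nf

/-- The argument `z ↦ u₀ cos z + u₃ sin z` is entire. [folklore] -/
private theorem differentiable_arg (U : SU2) :
    Differentiable ℂ fun z : ℂ => (u0 U : ℂ) * Complex.cos z + (u3 U : ℂ) * Complex.sin z :=
  ((differentiable_const _).mul Complex.differentiable_cos).add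
    ((differentiable_const _).mul Complex.differentiable_sin)

/-- **(A₁), (2.7)(ii): `z ↦ g̃_HK(u, z)` is ENTIRE** for every fixed `u ∈ SU(2)` — «A little exercise shows that
g̃_HK^{(0)}(u, z) is for fixed u an entire holomorphic function of z ∈ ℂ» (p.266 L.8–9); «(A₁) … entire holomorphic in z
for fixed u». [cite: MullerSchiemann1987, p.266 L.8–9; (A₁) p.266; (2.7)(ii) p.264] -/
theorem differentiable_gTildeHK (hγ : 0 < γ) (U : SU2) : Differentiable ℂ (gTildeHK γ U) :=
  (differentiable_hTr hγ).comp (differentiable_arg U)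

/-- **(A₁), (2.7)(i): `u ↦ g̃_HK(u, z)` is continuous on `SU(2)`** for every fixed `z ∈ ℂ`.
[cite: MullerSchiemann1987, (A₁) p.266; (2.7)(i) p.264] -/
theorem continuous_gTildeHK_left (hγ : 0 < γ) (z : ℂ) : Continuous fun U : SU2 => gTildeHK γ U z := by
  unfold gTildeHK
  refine (continuous_hTr hγ).comp ?_
  exact ((Complex.continuous_ofReal.comp continuous_u0).mul continuous_const).add
    ((Complex.continuous_ofReal.comp continuous_u3).mul continuous_const)

/-- Joint continuity in `(u, z)`. [cite: MullerSchiemann1987, (A₁) p.266] -/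
theorem continuous_gTildeHK (hγ : 0 < γ) : Continuous fun p : SU2 × ℂ => gTildeHK γ p.1 p.2 := by
  unfold gTildeHK
  refine (continuous_hTr hγ).comp ?_
  exact ((Complex.continuous_ofReal.comp (continuous_u0.comp continuous_fst)).mul
      (Complex.continuous_cos.comp continuous_snd)).add
    ((Complex.continuous_ofReal.comp (continuous_u3.comp continuous_fst)).mul
      (Complex.continuous_sin.comp continuous_snd))

/-- **(2.7)(ii), «real analytic»: `g̃_HK(u, x)` is real for real `x`.** [cite: MullerSchiemann1987, (2.7)(ii) p.264] -/
theorem gTildeHK_im_ofReal (hγ : 0 < γ) (U : SU2) (x : ℝ) : (gTildeHK γ U (x : ℂ)).im = 0 := by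
  rw [gTildeHK_ofReal hγ, Complex.ofReal_im]

/-- **(A₁): `g(u) = g̃(u, 0)`** — at `z = 0` the continued factor is the heat-kernel Gibbs factor `g_HK(u)` itself, which
is real, positive and satisfies (2.1)–(2.3) (`MS87HeatKernelSU2.gHK_pos`, `gHK_one`, `gHK_conj`, `gHK_inv`).
[cite: MullerSchiemann1987, (A₁) p.266] -/
theorem gTildeHK_zero (hγ : 0 < γ) (U : SU2) : gTildeHK γ U 0 = ((gHK γ U : ℝ) : ℂ) := by
  have := gTildeHK_ofReal hγ U 0
  rwa [Complex.ofReal_zero, diagPhase_zero, one_mul] at this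

/-- **(2.8)**: `g̃_HK(e^{−ix′σ₃}u, z) = g̃_HK(u, x′ + z)` for `x′ ∈ ℝ`, `z ∈ ℂ`. [cite: MullerSchiemann1987, (2.8) p.264] -/
theorem gTildeHK_diagPhase_mul (γ : ℝ) (x' : ℝ) (U : SU2) (z : ℂ) :
    gTildeHK γ (diagPhase x' * U) z = gTildeHK γ U ((x' : ℂ) + z) := by
  unfold gTildeHK
  rw [u0_diagPhase_mul, u3_diagPhase_mul, Complex.cos_add, Complex.sin_add, ← Complex.ofReal_cos,
    ← Complex.ofReal_sin]
  push_cast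
  ring_nf

/-- **(2.9)**: `g̃_HK(u, z) = g̃_HK(u⁻¹, −z)`. [cite: MullerSchiemann1987, (2.9) p.264] -/
theorem gTildeHK_inv_neg (γ : ℝ) (U : SU2) (z : ℂ) : gTildeHK γ U⁻¹ (-z) = gTildeHK γ U z := by
  unfold gTildeHK
  rw [u0_inv, u3_inv, Complex.cos_neg, Complex.sin_neg]
  push_cast
  ring_nf

/-- **(2.10)**: at the unit element the continued factor is the function `h` of the complex central angle —
`g̃_HK(e₀, z) = h(z)` (`= hC γ z` of `MS87HeatKernelComplex`; (2.16): `g(e^{−iθσ₃}) = h(θ)`).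
[cite: MullerSchiemann1987, (2.10) p.264, (2.16) p.265] -/
theorem gTildeHK_one (γ : ℝ) (z : ℂ) : gTildeHK γ 1 z = hC γ z := by
  unfold gTildeHK
  rw [u0_one, u3_one, hC_eq_hTr_cos]
  push_cast
  ring_nf

/-- (2.10) with (2.6): for real `x`, `h(x) = g_HK(e^{−ixσ₃})`. [cite: MullerSchiemann1987, (2.10) p.264, (2.16) p.265] -/
theorem hC_ofReal_eq_gHK_diagPhase (hγ : 0 < γ) (x : ℝ) :
    hC γ (x : ℂ) = ((gHK γ (diagPhase x) : ℝ) : ℂ) := by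
  rw [← gTildeHK_one, gTildeHK_ofReal hγ, mul_one]

/-- **(2.11)**: `h(z + π) = h(z − π)` (period `2π`). [cite: MullerSchiemann1987, (2.11) p.264] -/
theorem hC_add_pi_eq_sub_pi (γ : ℝ) (z : ℂ) : hC γ (z + π) = hC γ (z - π) := by
  have := hC_add_two_pi γ (z - π)
  rw [← this]
  congr 1
  ring

/-- **(2.12)**: `h(z) = h(−z)` (restated from `MS87HeatKernelComplex.hC_neg`). [cite: MullerSchiemann1987, (2.12) p.264] -/
theorem hC_even (γ : ℝ) (z : ℂ) : hC γ z = hC γ (-z) := (hC_neg γ z).symm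

/-- **HYPOTHESIS (A₁) OF SECT. 3 HOLDS FOR THE HEAT-KERNEL ACTION** (the base case `n = 0` of the induction of
Theorem 1 for the initial Gibbs factor (2.20), as far as (A₁) is concerned): *«(A₁) General Properties. g̃(u, z) is
continuous in u ∈ G for fixed z ∈ ℂ and entire holomorphic in z for fixed u. Moreover g(u) = g̃(u, 0) is real and
positive, satisfying (2.1)–(2.3).»* — for `g̃ = g̃_HK`, `g = g_HK`. [cite: MullerSchiemann1987, (A₁) p.266; p.266 L.2–9] -/
theorem A1_heatKernel (hγ : 0 < γ) :
    (∀ z : ℂ, Continuous fun U : SU2 => gTildeHK γ U z) ∧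
    (∀ U : SU2, Differentiable ℂ (gTildeHK γ U)) ∧
    (∀ U : SU2, gTildeHK γ U 0 = ((gHK γ U : ℝ) : ℂ)) ∧
    (∀ U : SU2, 0 < gHK γ U) ∧
    gHK γ 1 = 1 ∧
    (∀ U V : SU2, gHK γ (V * U * V⁻¹) = gHK γ U) ∧
    (∀ U : SU2, gHK γ U⁻¹ = gHK γ U) :=
  ⟨continuous_gTildeHK_left hγ, differentiable_gTildeHK hγ, gTildeHK_zero hγ, gHK_pos hγ, gHK_one hγ,
    fun U V => gHK_conj γ U V, gHK_inv γ⟩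

/-! ## §4 (2.21) as printed: the characters as polynomials of the trace -/

/-- The binomial sum `B_n(t) = Σ_{k=0}^{n} (−1)^k binom(n−k, k) t^{n−2k}` (terms with `2k > n` vanish since then
`binom(n−k, k) = 0`) — the inner sum of (2.21) with `n = l − 1`. [cite: MullerSchiemann1987, (2.21) p.266] -/
def binomSum (n : ℕ) (t : ℂ) : ℂ :=
  ∑ k ∈ Finset.range (n + 1), (-1 : ℂ) ^ k * ((n - k).choose k : ℂ) * t ^ (n - 2 * k)

/-- `B_0 = 1` (`= U_0`). [cite: MullerSchiemann1987, (2.21) p.266] -/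
theorem binomSum_zero (t : ℂ) : binomSum 0 t = 1 := by
  simp [binomSum]

/-- `B_1(t) = t` (`= U_1(t/2)`). [cite: MullerSchiemann1987, (2.21) p.266] -/
theorem binomSum_one (t : ℂ) : binomSum 1 t = t := by
  simp [binomSum, Finset.sum_range_succ]

/-- The two-step recursion `B_{n+2}(t) = t·B_{n+1}(t) − B_n(t)` (Pascal's rule) — the Chebyshev recursion of the
characters «as polynomials of trace u, [12]». [cite: MullerSchiemann1987, (2.21) p.266] -/
theorem binomSum_add_two (n : ℕ) (t : ℂ) : binomSum (n + 2) t = t * binomSum (n + 1) t - binomSum n t := by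
  -- `t · B_{n+1}(t)` with the power raised by one (the terms with `2k > n+1` vanish on both sides)
  have hmul : t * binomSum (n + 1) t =
      ∑ k ∈ Finset.range (n + 1 + 1), (-1 : ℂ) ^ k * ((n + 1 - k).choose k : ℂ) * t ^ (n + 2 - 2 * k) := by
    unfold binomSum
    rw [Finset.mul_sum]
    refine Finset.sum_congr rfl fun k hk => ?_
    rw [Finset.mem_range] at hk
    by_cases h2 : 2 * k ≤ n + 1
    · have he : n + 2 - 2 * k = (n + 1 - 2 * k) + 1 := by omega
      rw [he, pow_succ]; ring
    · have hz : (n + 1 - k).choose k = 0 := Nat.choose_eq_zero_of_lt (by omega)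
      rw [hz]; simp
  -- Pascal, term by term: `F(k+1) + f(k) = g(k+1)` for `k ≤ n`
  have key : ∀ k ∈ Finset.range (n + 1),
      (-1 : ℂ) ^ (k + 1) * ((n + 2 - (k + 1)).choose (k + 1) : ℂ) * t ^ (n + 2 - 2 * (k + 1))
        = (-1 : ℂ) ^ (k + 1) * ((n + 1 - (k + 1)).choose (k + 1) : ℂ) * t ^ (n + 2 - 2 * (k + 1))
          - (-1 : ℂ) ^ k * ((n - k).choose k : ℂ) * t ^ (n - 2 * k) := by
    intro k hk
    rw [Finset.mem_range] at hk
    have e1 : n + 2 - (k + 1) = (n - k) + 1 := by omega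
    have e2 : n + 1 - (k + 1) = n - k := by omega
    have e3 : n + 2 - 2 * (k + 1) = n - 2 * k := by omega
    rw [e1, e2, e3, Nat.choose_succ_succ, Nat.cast_add, pow_succ]
    ring
  rw [hmul]
  unfold binomSum
  rw [Finset.sum_range_succ' _ (n + 2), Finset.sum_range_succ _ (n + 1), Finset.sum_range_succ' _ (n + 1),
    Finset.sum_congr rfl key, Finset.sum_sub_distrib]
  have hlast : ((n + 2 - (n + 1 + 1)).choose (n + 1 + 1) : ℂ) = 0 := by
    rw [show n + 2 - (n + 1 + 1) = 0 by omega, Nat.choose_zero_succ, Nat.cast_zero]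
  rw [hlast]
  simp only [Nat.sub_zero, Nat.choose_zero_right, Nat.cast_one, pow_zero, one_mul, mul_zero, zero_mul,
    add_zero, mul_one]
  ring

/-- **`S_n(t) = B_n(t)`** for Mathlib's rescaled Chebyshev polynomials `S_n` (`S_0 = 1`, `S_1 = X`,
`S_{n+2} = X S_{n+1} − S_n`): the characters as polynomials of the trace. [cite: MullerSchiemann1987, (2.21) p.266] -/
theorem chebyshevS_eval_eq_binomSum (t : ℂ) (n : ℕ) :
    (Polynomial.Chebyshev.S ℂ (n : ℤ)).eval t = binomSum n t := by
  induction n using Nat.twoStepInduction with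
  | zero => simp [binomSum_zero]
  | one => simp [binomSum_one]
  | more n h0 h1 =>
    have hrec : Polynomial.Chebyshev.S ℂ ((n + 2 : ℕ) : ℤ) =
        Polynomial.X * Polynomial.Chebyshev.S ℂ ((n + 1 : ℕ) : ℤ) - Polynomial.Chebyshev.S ℂ (n : ℤ) := by
      have := Polynomial.Chebyshev.S_add_two ℂ (n : ℤ)
      push_cast at this ⊢
      exact this
    rw [hrec, Polynomial.eval_sub, Polynomial.eval_mul, Polynomial.eval_X, h0, h1, binomSum_add_two]

/-- **The characters as polynomials of the trace**: `U_n(t/2) = Σ_{k=0}^{n} (−1)^k binom(n−k, k) t^{n−2k}`, i.e.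
`U_n(c) = B_n(2c)` (`χ_{n/2}(u) = U_n(½ tr u)`; «Expressing the characters χ_j(u) as polynomials of trace u, [12]»).
[cite: MullerSchiemann1987, (2.21) p.266] -/
theorem chebyshevU_eval_eq_binomSum (c : ℂ) (n : ℕ) :
    (Polynomial.Chebyshev.U ℂ (n : ℤ)).eval c = binomSum n (2 * c) := by
  rw [← Polynomial.Chebyshev.S_comp_two_mul_X, Polynomial.eval_comp, chebyshevS_eval_eq_binomSum]
  congr 1
  simp

/-- The inner sum of (2.21) may be stopped at `[n/2]`: the terms with `2k > n` vanish. [cite: MullerSchiemann1987, (2.21) p.266] -/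
theorem binomSum_eq_sum_half (n : ℕ) (t : ℂ) :
    binomSum n t = ∑ k ∈ Finset.range (n / 2 + 1), (-1 : ℂ) ^ k * ((n - k).choose k : ℂ) * t ^ (n - 2 * k) := by
  unfold binomSum
  symm
  refine Finset.sum_subset (fun k hk => ?_) (fun k hk hk' => ?_)
  · rw [Finset.mem_range] at hk ⊢; omega
  · rw [Finset.mem_range] at hk hk'
    have hz : (n - k).choose k = 0 := Nat.choose_eq_zero_of_lt (by omega)
    rw [hz]; simp

/-- `trace(e^{−izσ₃}u) := e^{−iz}u₀₀ + e^{iz}u₁₁` for COMPLEX `z` (the matrix `e^{−izσ₃}u` then lies in `SL(2, ℂ)`;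
only its trace enters (2.21)). [cite: MullerSchiemann1987, (2.21) p.266] -/
def tracePhase (U : SU2) (z : ℂ) : ℂ :=
  Complex.exp (-(Complex.I * z)) * (U : Matrix (Fin 2) (Fin 2) ℂ) 0 0 +
    Complex.exp (Complex.I * z) * (U : Matrix (Fin 2) (Fin 2) ℂ) 1 1

/-- **`trace(e^{−izσ₃}u) = 2(u₀ cos z + u₃ sin z)`** — (2.17) continued to complex `z`.
[cite: MullerSchiemann1987, (2.17) p.265, (2.21) p.266] -/
theorem tracePhase_eq (U : SU2) (z : ℂ) :
    tracePhase U z = 2 * ((u0 U : ℂ) * Complex.cos z + (u3 U : ℂ) * Complex.sin z) := by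
  unfold tracePhase
  rw [QuantumLattice.su2_apply_11, val_zero_zero_eq, Complex.cos, Complex.sin]
  simp only [map_add, map_mul, Complex.conj_ofReal, Complex.conj_I]
  rw [show -(Complex.I * z) = -z * Complex.I by ring, show Complex.I * z = z * Complex.I by ring]
  ring

/-- For real `x`, `tracePhase u x` IS the trace of the group element `e^{−ixσ₃}u`. [cite: MullerSchiemann1987, (2.16)–(2.17) p.265] -/
theorem tracePhase_ofReal (U : SU2) (x : ℝ) :
    tracePhase U (x : ℂ) = Matrix.trace ((diagPhase x * U : SU2) : Matrix (Fin 2) (Fin 2) ℂ) := by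
  rw [Matrix.trace_fin_two, Submonoid.coe_mul, coe_diagPhase, Matrix.mul_apply, Matrix.mul_apply,
    Fin.sum_univ_two, Fin.sum_univ_two, tracePhase]
  simp only [Matrix.of_apply, Matrix.cons_val', Matrix.cons_val_zero, Matrix.cons_val_one,
    Matrix.cons_val_fin_one, Matrix.empty_val', zero_mul, add_zero, zero_add]
  push_cast
  ring_nf

/-- **(2.21) AS PRINTED** (index `l ≥ 1` written `l + 1` with `l ∈ ℕ`):
`g̃_HK(u, z) = 𝒩 Σ_{l≥1} l e^{−l²/(4γ)} Σ_{k=0}^{[(l−1)/2]} (−1)^k binom(l−1−k, k) {trace(e^{−izσ₃}u)}^{l−1−2k}`.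
[cite: MullerSchiemann1987, (2.21) p.266] -/
theorem gTildeHK_eq_printed (γ : ℝ) (U : SU2) (z : ℂ) :
    gTildeHK γ U z = (normN γ : ℂ) * ∑' l : ℕ,
      (((l : ℝ) + 1) * Real.exp (-(((l : ℝ) + 1) ^ 2 / (4 * γ))) : ℝ) *
        ∑ k ∈ Finset.range (l / 2 + 1),
          (-1 : ℂ) ^ k * ((l - k).choose k : ℂ) * (tracePhase U z) ^ (l - 2 * k) := by
  unfold gTildeHK hTr
  congr 1
  refine tsum_congr fun l => ?_
  rw [termU, chebyshevU_eval_eq_binomSum, binomSum_eq_sum_half, ← tracePhase_eq, coefA1]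
  congr 1
  have h := congrArg (fun r : ℝ => (r : ℂ)) (nome_pow_sq γ (l + 1))
  push_cast at h ⊢
  rw [h]

end OnTheGroupHK

end HeatKernel

end MullerSchiemann1987

end Literature.MathematicalPhysics.QuantumFieldTheory
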